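import Summits.Ventures.PercRepro.MSTightRemovableInstance
import Summits.Ventures.PercRepro.MSTightTraceTL
import Summits.Ventures.PercRepro.ExcessOneResidueEmpty
import Summits.Ventures.PercRepro.ExcessOneMerge

/-!
# (SING-t) at every removable or addable tight-trace element of a residue instance

Dossier proofs/MINE1-theoremS.md, Addendum 36 (Symmetries) and Addendum 41. A **residue
instance** `(F, u)` of the V lane (`Residue F u`) is a family of MS-excess one without twins,
with empty core and full support, valid, `∅, univ ∉ F`, `u, ū ∉ F`, every member A- or
C*-signable for `u`, and neither `F ∪ {u}` nor `F ∪ {ū}` tight. The two symmetries of the lane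
are theorems here: `(F, u) ↦ (F, ū)` (`Residue.swap`) and the complementation
`(F, u) ↦ (F*, u)` with `F* = {univ ∖ t : t ∈ F}` (`compls`, `Residue.compls`) — it preserves
the differences (`diffs_compls`), tightness (`tight_compls_iff`, `tight_proj_compls_iff`), twins
and validity, exchanges A and C*, `∅` and `univ`, and exchanges removable with addable
(`partr_compls_subset_of_addable`, `part0_compls_subset_of_removable`) and Case I with Case II.
With Lemma 1 (MSTightTraceTL.lean: removable ⟹ Case I) and the removable Case I theorem
(MSTightRemovableInstance.lean) this gives **(SING-t) at every removable or addable
tight-trace element** (`sing_of_removable_or_addable`): `{r} ∈ F` or `univ ∖ r ∈ F`.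

The last section (Addendum 42) isolates THE EXACT OPEN PIECE: `SingNonMonotone α` is (SING-t) at a
tight-trace element `r ∈ u` in the NON-MONOTONE Case I (`u ∖ r ∈ F`, a partnerless member through
`r`, a member avoiding `r` without its `r`-partner) — a candidate Prop, never asserted — and
`sing_t_of_singNonMonotone` says that under it (SING-t) holds at EVERY tight-trace element of a
residue instance: for `r ∈ u` Lemma 1 gives Case I (settled above when `r` is removable or addable,
by the candidate otherwise) or Case II, which is Case I for `F*` with removable and addable
exchanged; for `r ∉ u` replace `u` by `ū`.
-/

namespace PercRepro.MSTight

open Finset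
open scoped FinsetFamily

variable {α : Type*} [DecidableEq α] [Fintype α]

section Compls

/-- `univ ∖ (univ ∖ t) = t`. -/
theorem compl_compl_eq (t : Finset α) : univ \ (univ \ t) = t :=
  Finset.sdiff_sdiff_eq_self (subset_univ t)

/-- Twins of a family are twins of its complement family. -/
theorem twin_compls_iff {F : Finset (Finset α)} {a b : α} :
    Twin (compls F) a b ↔ Twin F a b := by
  constructor
  · intro h t ht
    have := h (univ \ t) (compl_mem_compls ht)
    simp only [mem_sdiff, mem_univ, true_and] at this
    tauto
  · intro h t ht
    rw [mem_compls] at ht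
    have := h _ ht
    simp only [mem_sdiff, mem_univ, true_and] at this
    tauto

/-- The trace of `F*` at `r` is the complement family of the trace of `F` inside `S' = univ ∖ r`. -/
theorem proj_compls (F : Finset (Finset α)) (r : α) :
    proj r (compls F) = (proj r F).image fun p => univ.erase r \ p := by
  ext p
  simp only [mem_proj, mem_image, mem_compls]
  constructor
  · rintro ⟨B, hB, rfl⟩
    refine ⟨(univ \ B).erase r, ⟨univ \ B, hB, rfl⟩, ?_⟩
    ext a; simp only [mem_sdiff, mem_erase, mem_univ, true_and, and_true, not_and]; tauto
  · rintro ⟨q, ⟨B, hB, rfl⟩, rfl⟩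
    refine ⟨univ \ B, by rw [compl_compl_eq]; exact hB, ?_⟩
    ext a; simp only [mem_sdiff, mem_erase, mem_univ, true_and, and_true, not_and]; tauto

omit [Fintype α] in
/-- `(S ∖ a) ∖ (S ∖ b) = b ∖ a` for `b ⊆ S`. -/
theorem sdiff_sdiff_sdiff_eq {S a b : Finset α} (hb : b ⊆ S) : (S \ a) \ (S \ b) = b \ a := by
  ext x
  constructor
  · intro hx
    obtain ⟨hx1, hx'⟩ := mem_sdiff.1 hx
    obtain ⟨hxS, hxa⟩ := mem_sdiff.1 hx1
    refine mem_sdiff.2 ⟨?_, hxa⟩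
    by_contra hxb
    exact hx' (mem_sdiff.2 ⟨hxS, hxb⟩)
  · intro hx
    obtain ⟨hxb, hxa⟩ := mem_sdiff.1 hx
    exact mem_sdiff.2 ⟨mem_sdiff.2 ⟨hb hxb, hxa⟩, fun h => (mem_sdiff.1 h).2 hxb⟩

omit [Fintype α] in
/-- The differences of `{S ∖ p : p ∈ P}` are the differences of `P`, for `P` a family of subsets
of `S`. -/
theorem diffs_image_sdiff_of_subset {S : Finset α} {P : Finset (Finset α)} (hP : ∀ p ∈ P, p ⊆ S) :
    (P.image fun p => S \ p) \\ (P.image fun p => S \ p) = P \\ P := by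
  ext E
  simp only [mem_diffs, mem_image]
  constructor
  · rintro ⟨a, ⟨a', ha', rfl⟩, b, ⟨b', hb', rfl⟩, rfl⟩
    exact ⟨b', hb', a', ha', (sdiff_sdiff_sdiff_eq (hP b' hb')).symm⟩
  · rintro ⟨a, ha, b, hb, rfl⟩
    exact ⟨S \ b, ⟨b, hb, rfl⟩, S \ a, ⟨a, ha, rfl⟩, sdiff_sdiff_sdiff_eq (hP a ha)⟩

omit [Fintype α] in
/-- `{S ∖ p : p ∈ P}` is tight iff `P` is, for `P` a family of subsets of `S`. -/
theorem tight_image_sdiff_iff {S : Finset α} {P : Finset (Finset α)} (hP : ∀ p ∈ P, p ⊆ S) :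
    Tight (P.image fun p => S \ p) ↔ Tight P := by
  unfold Tight
  rw [diffs_image_sdiff_of_subset hP, card_image_of_injOn]
  intro a ha b hb h
  exact eq_of_sdiff_eq_of_subset (hP a (mem_coe.1 ha)) (hP b (mem_coe.1 hb)) h

/-- The trace of `F*` at `r` is tight iff the trace of `F` is. -/
theorem tight_proj_compls_iff (F : Finset (Finset α)) (r : α) :
    Tight (proj r (compls F)) ↔ Tight (proj r F) := by
  rw [proj_compls]
  refine tight_image_sdiff_iff ?_
  intro p hp
  obtain ⟨t, -, rfl⟩ := mem_proj.1 hp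
  exact erase_subset_erase r (subset_univ t)

/-- `univ ∖ insert r t = (univ ∖ t).erase r`. -/
theorem compl_insert_eq (r : α) (t : Finset α) : univ \ insert r t = (univ \ t).erase r := by
  ext a; simp only [mem_sdiff, mem_univ, true_and, mem_insert, not_or, mem_erase]

/-- An addable element of `F` is removable for `F*`. -/
theorem partr_compls_subset_of_addable {F : Finset (Finset α)} {r : α}
    (hadd : part0 r F ⊆ partr r F) : partr r (compls F) ⊆ part0 r (compls F) := by
  intro s hs
  obtain ⟨hrs, hs'⟩ := mem_partr.1 hs
  rw [mem_compls, compl_insert_eq] at hs'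
  have h0 : (univ \ s).erase r ∈ part0 r F := mem_part0.2 ⟨hs', notMem_erase r _⟩
  have h1 := (mem_partr.1 (hadd h0)).2
  rw [insert_erase (mem_sdiff.2 ⟨mem_univ r, hrs⟩)] at h1
  exact mem_part0.2 ⟨mem_compls.2 h1, hrs⟩

/-- A removable element of `F` is addable for `F*`. -/
theorem part0_compls_subset_of_removable {F : Finset (Finset α)} {r : α}
    (hrem : partr r F ⊆ part0 r F) : part0 r (compls F) ⊆ partr r (compls F) := by
  intro s hs
  obtain ⟨hs', hrs⟩ := mem_part0.1 hs
  rw [mem_compls] at hs'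
  have hr : r ∈ univ \ s := mem_sdiff.2 ⟨mem_univ r, hrs⟩
  have h1 : (univ \ s).erase r ∈ partr r F :=
    mem_partr.2 ⟨notMem_erase r _, by rw [insert_erase hr]; exact hs'⟩
  have h2 := (mem_part0.1 (hrem h1)).1
  refine mem_partr.2 ⟨hrs, ?_⟩
  rw [mem_compls, compl_insert_eq]; exact h2

/-- Complementation exchanges the two cells of `u` at `t` with the cells of `ū`. -/
theorem cells_compl_left {D : Finset (Finset α)} {t v : Finset α} :
    Cells D (univ \ t) v ↔ Cells D t (univ \ v) := by
  unfold Cells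
  rw [compl_compl_eq, compl_compl_eq]
  constructor
  · rintro ⟨h1, h2⟩; exact ⟨h2, h1⟩
  · rintro ⟨h1, h2⟩; exact ⟨h2, h1⟩

end Compls

/-- A residue instance `(F, u)` of the V lane (Addendum 36, Setting). -/
structure Residue (F : Finset (Finset α)) (u : Finset α) : Prop where
  /-- MS-excess one -/
  hexc : (F \\ F).card = F.card + 1
  /-- no twins -/
  htf : ∀ a b, Twin F a b → a = b
  /-- empty core -/
  hcore : ∀ a, ∃ t ∈ F, a ∉ t
  /-- full support -/
  hsupp : ∀ a, ∃ t ∈ F, a ∈ t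
  /-- `∅ ∉ F` -/
  hempty : (∅ : Finset α) ∉ F
  /-- `univ ∉ F` -/
  huniv : (univ : Finset α) ∉ F
  /-- valid: no complementary pair -/
  hvalid : ∀ t ∈ F, univ \ t ∉ F
  /-- `u ∉ F` -/
  hu : u ∉ F
  /-- `ū ∉ F` -/
  hu' : univ \ u ∉ F
  /-- every member is A- or C*-signable -/
  hsig : ∀ t ∈ F, Cells (F \\ F) t u ∨ Cells (F \\ F) t (univ \ u)
  /-- `F ∪ {u}` is not tight -/
  hnt : ¬ Tight (insert u F)
  /-- `F ∪ {ū}` is not tight -/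
  hnt' : ¬ Tight (insert (univ \ u) F)

namespace Residue

variable {F : Finset (Finset α)} {u : Finset α}

/-- `F` is nonempty. -/
theorem nonempty (h : Residue F u) : F.Nonempty := by
  by_contra hne
  rw [not_nonempty_iff_eq_empty] at hne
  have := h.hexc
  rw [hne] at this
  simp at this

/-- **The symmetry `(F, u) ↦ (F, ū)`.** -/
theorem swap (h : Residue F u) : Residue F (univ \ u) where
  hexc := h.hexc
  htf := h.htf
  hcore := h.hcore
  hsupp := h.hsupp
  hempty := h.hempty
  huniv := h.huniv
  hvalid := h.hvalid
  hu := h.hu'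
  hu' := by rw [compl_compl_eq]; exact h.hu
  hsig := by
    intro t ht
    rw [compl_compl_eq]
    exact (h.hsig t ht).symm
  hnt := h.hnt'
  hnt' := by rw [compl_compl_eq]; exact h.hnt

/-- **The symmetry `(F, u) ↦ (F*, u)`.** -/
theorem compls (h : Residue F u) : Residue (compls F) u where
  hexc := by rw [diffs_compls, card_compls]; exact h.hexc
  htf := fun a b hab => h.htf a b (twin_compls_iff.1 hab)
  hcore := by
    intro a
    obtain ⟨t, ht, hat⟩ := h.hsupp a
    exact ⟨univ \ t, compl_mem_compls ht, fun h' => (mem_sdiff.1 h').2 hat⟩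
  hsupp := by
    intro a
    obtain ⟨t, ht, hat⟩ := h.hcore a
    exact ⟨univ \ t, compl_mem_compls ht, mem_sdiff.2 ⟨mem_univ a, hat⟩⟩
  hempty := by rw [mem_compls, sdiff_empty]; exact h.huniv
  huniv := by rw [mem_compls, Finset.sdiff_self]; exact h.hempty
  hvalid := by
    intro t ht ht'
    rw [mem_compls] at ht
    rw [mem_compls, compl_compl_eq] at ht'
    exact h.hvalid t ht' ht
  hu := by rw [mem_compls]; exact h.hu'
  hu' := by rw [mem_compls, compl_compl_eq]; exact h.hu
  hsig := by
    intro t ht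
    obtain ⟨s, hs, rfl⟩ := mem_image.1 ht
    rw [diffs_compls, cells_compl_left, cells_compl_left, compl_compl_eq]
    exact (h.hsig s hs).symm
  hnt := by
    rw [← compl_compl_eq u, ← compls_insert, tight_compls_iff]
    exact h.hnt'
  hnt' := by
    rw [← compls_insert, tight_compls_iff]
    exact h.hnt

end Residue

/-- `univ ∖ {r} = univ.erase r`. -/
theorem compl_singleton_eq (r : α) : univ \ {r} = univ.erase r := sdiff_singleton_eq_erase r univ

/-- `univ ∖ univ.erase r = {r}`. -/
theorem compl_erase_eq (r : α) : univ \ univ.erase r = {r} := by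
  ext a; simp only [mem_sdiff, mem_univ, true_and, mem_erase, not_and, mem_singleton]; tauto

/-- The conclusion of (SING-t) for `F*` is the conclusion for `F`. -/
theorem sing_of_sing_compls {F : Finset (Finset α)} {r : α}
    (h : ({r} : Finset α) ∈ compls F ∨ univ.erase r ∈ compls F) :
    ({r} : Finset α) ∈ F ∨ univ.erase r ∈ F := by
  rw [mem_compls, mem_compls, compl_singleton_eq, compl_erase_eq] at h
  exact h.symm

/-- **(SING-t) at a removable element `r ∈ u`** (Lemma 1 + the removable Case I theorem). -/
theorem singleton_mem_or_erase_mem_of_removable' {F : Finset (Finset α)} {r : α} {u : Finset α}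
    (h : Residue F u) (hP : Tight (proj r F)) (hru : r ∈ u) (hrem : partr r F ⊆ part0 r F) :
    ({r} : Finset α) ∈ F ∨ univ.erase r ∈ F :=
  singleton_mem_or_erase_mem_of_removable h.hexc hP h.htf h.hcore h.hsupp h.hempty h.huniv h.hvalid
    h.hu h.hu' h.hsig h.hnt hru hrem
    (erase_mem_of_removable hP h.nonempty hru h.hu h.hu' h.hsig hrem)

/-- **(SING-t) at an addable element `r ∈ u`** (by complementation). -/
theorem singleton_mem_or_erase_mem_of_addable {F : Finset (Finset α)} {r : α} {u : Finset α}
    (h : Residue F u) (hP : Tight (proj r F)) (hru : r ∈ u) (hadd : part0 r F ⊆ partr r F) :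
    ({r} : Finset α) ∈ F ∨ univ.erase r ∈ F :=
  sing_of_sing_compls (singleton_mem_or_erase_mem_of_removable' h.compls
    ((tight_proj_compls_iff F r).2 hP) hru (partr_compls_subset_of_addable hadd))

/-- **(SING-t) at every removable or addable tight-trace element, `r ∈ u`.** -/
theorem sing_of_removable_or_addable_of_mem {F : Finset (Finset α)} {r : α} {u : Finset α}
    (h : Residue F u) (hP : Tight (proj r F)) (hru : r ∈ u)
    (hra : partr r F ⊆ part0 r F ∨ part0 r F ⊆ partr r F) :
    ({r} : Finset α) ∈ F ∨ univ.erase r ∈ F := by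
  rcases hra with hrem | hadd
  · exact singleton_mem_or_erase_mem_of_removable' h hP hru hrem
  · exact singleton_mem_or_erase_mem_of_addable h hP hru hadd

/-- **(SING-t) at every removable or addable tight-trace element of a residue instance**
(Addendum 41): for `(F, u)` a residue instance and `r` with a tight trace, if every member
through `r` stays a member without `r` (removable) or every member avoiding `r` is a member
with `r` (addable), then `{r} ∈ F` or `univ ∖ r ∈ F`. -/
theorem sing_of_removable_or_addable {F : Finset (Finset α)} {r : α} {u : Finset α}
    (hexc : (F \\ F).card = F.card + 1) (hP : Tight (proj r F)) (htf : ∀ a b, Twin F a b → a = b)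
    (hcore : ∀ a, ∃ t ∈ F, a ∉ t) (hsupp : ∀ a, ∃ t ∈ F, a ∈ t) (hempty : (∅ : Finset α) ∉ F)
    (huniv : (univ : Finset α) ∉ F) (hvalid : ∀ t ∈ F, univ \ t ∉ F) (hu : u ∉ F)
    (hu' : univ \ u ∉ F) (hsig : ∀ t ∈ F, Cells (F \\ F) t u ∨ Cells (F \\ F) t (univ \ u))
    (hnt : ¬ Tight (insert u F)) (hnt' : ¬ Tight (insert (univ \ u) F))
    (hra : partr r F ⊆ part0 r F ∨ part0 r F ⊆ partr r F) :
    ({r} : Finset α) ∈ F ∨ univ.erase r ∈ F := by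
  have h : Residue F u :=
    ⟨hexc, htf, hcore, hsupp, hempty, huniv, hvalid, hu, hu', hsig, hnt, hnt'⟩
  by_cases hru : r ∈ u
  · exact sing_of_removable_or_addable_of_mem h hP hru hra
  · exact sing_of_removable_or_addable_of_mem h.swap hP (mem_sdiff.2 ⟨mem_univ r, hru⟩) hra

section NonMonotone

variable (α)

/-- **The non-monotone Case I of (SING-t), as a candidate Prop** (Addendum 42): in a residue
instance `(F, u)`, an element `r ∈ u` with a tight trace, `u ∖ r ∈ F`, a partnerless member
through `r` and a member avoiding `r` without its `r`-partner has `{r} ∈ F` or `univ ∖ r ∈ F`. -/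
def SingNonMonotone : Prop :=
  ∀ (F : Finset (Finset α)) (u : Finset α) (r : α), Residue F u → Tight (proj r F) → r ∈ u →
    u.erase r ∈ F → ¬ partr r F ⊆ part0 r F → ¬ part0 r F ⊆ partr r F →
    ({r} : Finset α) ∈ F ∨ univ.erase r ∈ F

variable {α}

/-- If `r` is not removable for `F`, it is not addable for `F*`. -/
theorem not_part0_compls_subset_of_not_removable {F : Finset (Finset α)} {r : α}
    (h : ¬ partr r F ⊆ part0 r F) : ¬ part0 r (compls F) ⊆ partr r (compls F) := by
  intro h'
  apply h
  have := partr_compls_subset_of_addable h'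
  rwa [compls_compls] at this

/-- If `r` is not addable for `F`, it is not removable for `F*`. -/
theorem not_partr_compls_subset_of_not_addable {F : Finset (Finset α)} {r : α}
    (h : ¬ part0 r F ⊆ partr r F) : ¬ partr r (compls F) ⊆ part0 r (compls F) := by
  intro h'
  apply h
  have := part0_compls_subset_of_removable h'
  rwa [compls_compls] at this

/-- (SING-t) at every tight-trace element `r ∈ u`, modulo `SingNonMonotone α`. -/
theorem sing_t_of_singNonMonotone_of_mem (hC : SingNonMonotone α) {F : Finset (Finset α)}
    {u : Finset α} {r : α} (h : Residue F u) (hP : Tight (proj r F)) (hru : r ∈ u) :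
    ({r} : Finset α) ∈ F ∨ univ.erase r ∈ F := by
  by_cases hra : partr r F ⊆ part0 r F ∨ part0 r F ⊆ partr r F
  · exact sing_of_removable_or_addable_of_mem h hP hru hra
  push Not at hra
  rcases erase_mem_or_compl_erase_mem hP h.nonempty hru h.hu h.hu' h.hsig with hI | hII
  · exact hC F u r h hP hru hI hra.1 hra.2
  · refine sing_of_sing_compls (hC (compls F) u r h.compls ((tight_proj_compls_iff F r).2 hP) hru
      ?_ (not_partr_compls_subset_of_not_addable hra.2)
      (not_part0_compls_subset_of_not_removable hra.1))
    rw [mem_compls]; exact hII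

/-- **(SING-t) at EVERY tight-trace element of a residue instance, modulo `SingNonMonotone α`**
(Addendum 42). -/
theorem sing_t_of_singNonMonotone (hC : SingNonMonotone α) {F : Finset (Finset α)} {r : α}
    {u : Finset α} (hexc : (F \\ F).card = F.card + 1) (hP : Tight (proj r F))
    (htf : ∀ a b, Twin F a b → a = b) (hcore : ∀ a, ∃ t ∈ F, a ∉ t) (hsupp : ∀ a, ∃ t ∈ F, a ∈ t)
    (hempty : (∅ : Finset α) ∉ F) (huniv : (univ : Finset α) ∉ F) (hvalid : ∀ t ∈ F, univ \ t ∉ F)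
    (hu : u ∉ F) (hu' : univ \ u ∉ F)
    (hsig : ∀ t ∈ F, Cells (F \\ F) t u ∨ Cells (F \\ F) t (univ \ u))
    (hnt : ¬ Tight (insert u F)) (hnt' : ¬ Tight (insert (univ \ u) F)) :
    ({r} : Finset α) ∈ F ∨ univ.erase r ∈ F := by
  have h : Residue F u :=
    ⟨hexc, htf, hcore, hsupp, hempty, huniv, hvalid, hu, hu', hsig, hnt, hnt'⟩
  by_cases hru : r ∈ u
  · exact sing_t_of_singNonMonotone_of_mem hC h hP hru
  · exact sing_t_of_singNonMonotone_of_mem hC h.swap hP (mem_sdiff.2 ⟨mem_univ r, hru⟩)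

end NonMonotone

end PercRepro.MSTight
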